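import Literature.Geometry.Riemannian.HamiltonHolonomySubalgebras
import Literature.Geometry.Riemannian.HamiltonNonnegCurvatureOperatorBlocks
import Literature.Geometry.Riemannian.PinchingEstimatesConstraints
import HarnessLib

/-!
# Hamilton 1986, §9: the six cases for the image of the curvature operator of a metric with
`Rm ≥ 0`, at a point and a frame (topic `Geometry/Riemannian`)

A brick of the printed proof of the named fact
`Literature.Geometry.Riemannian.hamilton_nonnegCurvatureOperator_classification_four`
(`HamiltonNCOClassification.lean`; R. S. Hamilton, *Four-manifolds with positive curvature
operator*, J. Differential Geom. 24 (1986), Thm. 1.3): the algebraic case list of §9, p. 178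
("Here are the possibilities in dimension 4, classified by the holonomy group"), proved for block
triples in `HamiltonHolonomySubalgebras.lean` (`HamiltonODE.hamilton_caseList_frame`), is
instantiated here with the ACTUAL blocks `(A, B, C) = (blockA, blockB, blockC)` of the curvature of
a Levi-Civita connection in a 4-frame (`CurvatureDecomposition.lean`), discharging every algebraic
hypothesis from the tree: `A`, `C` symmetric (`blockA_isSymm`, `blockC_isSymm`), `tr A = tr C`
(the first Bianchi identity, `trace_blockA_eq_trace_blockC`, `PinchingEstimatesConstraints.lean`)
and `M ≥ 0` from `Rm ≥ 0` (`HasNonnegCurvatureOperatorWith.operatorGE_zero_blocks`,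
`HamiltonNonnegCurvatureOperatorBlocks.lean`). The one remaining hypothesis is the output of
Lemma 8.2 / Thm. 8.3 for the evolved metric — the null space of `M` is killed by the Lie square
of the frame convention, `M v = 0 ⇒ ᵗx A^# x - 2 ᵗx B^# y + ᵗy C^# y = 0` — which needs the
strong maximum principle and is NOT proved in the tree.

* `hamilton_caseList_blocks` — for `(g, cov)` with `cov` a Levi-Civita connection of the `C^n`
  metric `g` (`n ≥ 2`) and `Rm ≥ 0` (`HasNonnegCurvatureOperatorWith`), at any point `x` and any
  4-frame `e`, under that null-space hypothesis: the blocks vanish (case 1); or the image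
  `𝔤 = Im M` has dimension `1` and is spanned by `θ` with `|θ₊| = |θ₋|` (case 2, a two-plane by
  `DecomposableBivectorsFour.lean`); or dimension `2` and `𝔤 = ℝ(φ,0) ⊕ ℝ(0,ψ)` (case 3); or
  dimension `3` and `𝔤` is the graph of an isometry `Λ²₊ → Λ²₋` of determinant `-1` (case 4); or
  dimension `4` containing a factor (case 5); or `M > 0` in the frame (case 6).

Theorems only; no definitions, no named facts.

## References

* R. S. Hamilton, *Four-manifolds with positive curvature operator*, J. Differential Geom. 24
  (1986) 153–179, §8, Lemma 8.2–Thm. 8.3 (pp. 174–176); §9, cases 1–6 (pp. 178–179).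
  [Hamilton1986]
-/

noncomputable section

open Bundle Set Function Matrix Finset Module
open scoped Manifold ContDiff Topology BigOperators

namespace Literature.Geometry.Riemannian

open Lorentzian Lorentzian.PseudoRiemannianMetric HamiltonODE

variable {E : Type*} [NormedAddCommGroup E] [NormedSpace ℝ E] {H : Type*} [TopologicalSpace H]
  {I : ModelWithCorners ℝ E H} {M : Type*} [TopologicalSpace M] [ChartedSpace H M]
  [IsManifold I ∞ M] {n : ℕ∞ω} [FiniteDimensional ℝ E] [CompleteSpace E]
  {g : PseudoRiemannianMetric I n E (TangentSpace I : M → Type _)}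
  {cov : CovariantDerivative I E (TangentSpace I : M → Type _)}

/-- **Hamilton 1986, §9 (p. 178), the six cases, for the curvature blocks of a metric with
`Rm ≥ 0`.** Let `cov` be a Levi-Civita connection of the `C^n` metric `g`, `n ≥ 2`, with
non-negative curvature operator, and let `(A, B, C)` be Hamilton's blocks of its curvature at `x`
in the 4-frame `e`. If the null space of `M = (A B; ᵗB C)` is killed by the Lie square of the
frame convention (`M v = 0 ⇒ ᵗx A^# x - 2 ᵗx B^# y + ᵗy C^# y = 0`, the conclusion of
Lemma 8.2 / Thm. 8.3 for the evolved metric, HYPOTHESIS `hnull`), then one of the six printed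
cases holds for `𝔤 = Im M`: `(A, B, C) = 0`; `dim 𝔤 = 1`, `𝔤 = ℝθ`, `|θ₊| = |θ₋|`; `dim 𝔤 = 2`,
`𝔤 = ℝ(φ,0) ⊕ ℝ(0,ψ)`; `dim 𝔤 = 3`, `𝔤 = {(x, Px)}`, `P` an isometry of determinant `-1`;
`dim 𝔤 = 4`, `𝔤 ⊃ so(3) × 0` or `0 × so(3)`; `M > 0`. (Symmetry of `A`, `C`, `tr A = tr C` and
`M ≥ 0` are discharged by `blockA_isSymm`, `blockC_isSymm`, `trace_blockA_eq_trace_blockC`,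
`HasNonnegCurvatureOperatorWith.operatorGE_zero_blocks`.)
[cite: Hamilton1986, §9, cases 1–6 (pp. 178–179); §8, Thm. 8.3 (p. 176)] -/
theorem hamilton_caseList_blocks (hLC : g.IsLeviCivita cov) (hn : 2 ≤ n)
    (hR : g.HasNonnegCurvatureOperatorWith cov) (x : M) (e : Fin 4 → TangentSpace I x)
    (hnull : ∀ v, act (g.blockA cov x e, g.blockB cov x e, g.blockC cov x e) v = 0 →
      sharpQuad (g.blockA cov x e, g.blockB cov x e, g.blockC cov x e) (flipSnd v) = 0) :
    (g.blockA cov x e, g.blockB cov x e, g.blockC cov x e) = (0 : Blocks) ∨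
    (finrank ℝ (LinearMap.range (actₗ (g.blockA cov x e, g.blockB cov x e, g.blockC cov x e))) = 1 ∧
      ∃ θ : (Fin 3 → ℝ) × (Fin 3 → ℝ), θ ≠ 0 ∧ θ.1 ⬝ᵥ θ.1 = θ.2 ⬝ᵥ θ.2 ∧
        ∀ u, u ∈ LinearMap.range (actₗ (g.blockA cov x e, g.blockB cov x e, g.blockC cov x e)) ↔
          ∃ t : ℝ, u = t • θ) ∨
    (finrank ℝ (LinearMap.range (actₗ (g.blockA cov x e, g.blockB cov x e, g.blockC cov x e))) = 2 ∧
      ∃ φ ψ : Fin 3 → ℝ, φ ≠ 0 ∧ ψ ≠ 0 ∧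
        ∀ u, u ∈ LinearMap.range (actₗ (g.blockA cov x e, g.blockB cov x e, g.blockC cov x e)) ↔
          ∃ s t : ℝ, u = (s • φ, t • ψ)) ∨
    (finrank ℝ (LinearMap.range (actₗ (g.blockA cov x e, g.blockB cov x e, g.blockC cov x e))) = 3 ∧
      ∃ P : (Fin 3 → ℝ) →ₗ[ℝ] (Fin 3 → ℝ), (∀ a b, P a ⬝ᵥ P b = a ⬝ᵥ b) ∧
        LinearMap.det P = -1 ∧
          ∀ u, u ∈ LinearMap.range (actₗ (g.blockA cov x e, g.blockB cov x e, g.blockC cov x e)) ↔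
            u.2 = P u.1) ∨
    (finrank ℝ (LinearMap.range (actₗ (g.blockA cov x e, g.blockB cov x e, g.blockC cov x e))) = 4 ∧
      ((∀ y : Fin 3 → ℝ, ((y, 0) : _ × _) ∈
          LinearMap.range (actₗ (g.blockA cov x e, g.blockB cov x e, g.blockC cov x e))) ∨
        ∀ y : Fin 3 → ℝ, ((0, y) : _ × _) ∈
          LinearMap.range (actₗ (g.blockA cov x e, g.blockB cov x e, g.blockC cov x e)))) ∨
    (∀ v, v ≠ 0 → 0 < quad (g.blockA cov x e, g.blockB cov x e, g.blockC cov x e) v) :=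
  hamilton_caseList_frame (p := (g.blockA cov x e, g.blockB cov x e, g.blockC cov x e))
    (blockA_isSymm hLC hn x e) (blockC_isSymm hLC hn x e)
    (fun v ↦ by
      have := hR.operatorGE_zero_blocks hLC hn x e v
      rwa [zero_mul] at this)
    (trace_blockA_eq_trace_blockC hLC hn x e) hnull

end Literature.Geometry.Riemannian

end
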